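import Literature.Computability.AlgebraicComplexity.BI17TensorCorollaryBridges
import Literature.Computability.AlgebraicComplexity.MultiplicityObstructionsProofs
import Literature.NumberTheory.DiophantineGeometry.GLPolynomialRepSemisimpleProofs
import Mathlib.Algebra.MvPolynomial.Funext
import HarnessLib

/-!
# The coordinate ring `ℂ[⊗³ℂ^m]` as a `GL_m × GL_m × GL_m`-module: substitution action, degree
# pieces, and complete reducibility of each slot action (Bürgisser–Ikenmeyer 2017 §5, infrastructure)

Plumbing for the `SL_m^3`-invariant theory of Bürgisser–Ikenmeyer, *Fundamental invariants of orbit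
closures*, J. Algebra 477 (2017) §5 (`O(⊗³ℂ^m)^{SL_m^3}`, eq. (5.1), TeX L1981–2008), whose statement
file `BI17FundamentalInvariantTensors.lean` renders invariance pointwise
(`IsSL3Invariant F : ∀ g₁ g₂ g₃ w, F((g₁⊗g₂⊗g₃)w) = F(w)`) and has no representation object. This file
supplies the object and the one representation-theoretic input the §5 proofs need (cell `val-lit`,
row BI2017-B; route note `HOME/bip/NOTE-t09g4-TensorReynolds-route.md`):

* `tensorCoordSubst A B C` — the `R`-algebra endomorphism of `R[⊗³] = MvPolynomial (ι × ι × ι) R`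
  substituting for the coordinate `X_p` the linear form `∑_q (A ⊗ B ⊗ C)_{p q} X_q`, i.e.
  `F ↦ F ∘ (A ⊗ B ⊗ C)` (`aeval_tensorPt_tensorCoordSubst`: `(tensorCoordSubst A B C F)(w) =
  F((A ⊗ B ⊗ C)·w)` with the tree's `actTensor`); it is an ANTI-homomorphism
  (`tensorCoordSubst_mul`), preserves degrees (`isHomogeneous_tensorCoordSubst`), and commutes with
  base change (`map_tensorCoordSubst`).
* `isSL3Invariant_iff_forall_tensorCoordSubst_eq` — BI's pointwise invariance is invariance under the
  substitutions by `SL³` (polynomial = function over `ℂ`).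
* `tensorCoordRep ι k` — the representation of `GL ι k × GL ι k × GL ι k` on `k[⊗³]` by
  `(g₁,g₂,g₃) ↦ tensorCoordSubst g₁ᵀ g₂ᵀ g₃ᵀ` (the transpose turns the anti-action into an action whose
  matrix coefficients are POLYNOMIAL in the `gᵢ`, exactly the twist used for forms in
  `isSemisimpleRepresentation_coordRep`, `MultiplicityObstructionsProofs`); its degree pieces
  `tensorCoordRepDeg ι k d` (subrepresentations on `homogeneousSubmodule _ k d`).
* **`isSemisimpleRepresentation_tensorCoordRepDeg_slot₁/₂/₃`** — on each degree piece, the action of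
  each single factor `GL ι k` (the other two factors trivial) is completely reducible: it is a
  polynomial representation (`exists_eval_tensorCoordRepDeg_slotᵢ`, by base change to the generic
  matrix `Matrix.mvPolynomialX`), so the tree's theorem
  `isSemisimpleRepresentation_of_forall_exists_eval` (Bläser–Ikenmeyer Thm. 10.9 / Etingof et al.
  Thm. 4.66, file `GLPolynomialRepSemisimpleProofs`) applies.
* **`isSemisimpleRepresentation_tensorCoordRepDeg_sl_slot₁/₂/₃`** — the same for the `SL ι ℂ` slots
  (over `ℂ`; `GL = ℂ^× · SL` and scalars act on the degree-`d` piece by `s^d`, so `SL`-stable =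
  `GL`-stable subspaces; the argument of `isSemisimpleRepresentation_coordRep_comp_toGL` for forms).

Why single factors suffice (route note): the §3 → §5 port of BI 2017 only consumes Reynolds SPLITTING
and invariant LIFTING, and for three commuting actions these follow from single-factor
semisimplicity by iterating inside `V^{G₁} ⊇ V^{G₁G₂}` (subrepresentations of semisimple
representations are semisimple, `isSemisimpleRepresentation_toRepresentation`). No three-block
Schur–Weyl duality is needed.

Honest framing: representation-theoretic bookkeeping for the `val-lit` BI17 tensor row; VP ≠ VNP is
NOT proved and nothing here is progress on it. Definitions are plumbing (no named facts).

## References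

* [BurgisserIkenmeyer2017] P. Bürgisser, C. Ikenmeyer, *Fundamental invariants of orbit closures*,
  J. Algebra 477 (2017) 390–434 = arXiv:1511.02927, §5 (TeX L1945–2008).
* [BlaeserIkenmeyer2025] M. Bläser, C. Ikenmeyer, *Introduction to Geometric Complexity Theory*,
  Thm. 10.9 with Example 11.2 (polynomial representations of `GL_N` are completely reducible).

## Mathlib and tree

Mathlib: `MvPolynomial.aeval`, `MvPolynomial.funext`, `MvPolynomial.map_aeval`/`coeff_map`,
`Matrix.mvPolynomialX_map_eval₂`, `Representation`, `Subrepresentation.toRepresentation`,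
`Representation.IsSemisimpleRepresentation`. Tree: `actTensor`, `actTensor_apply`,
`actTensor_actTensor`, `actTensor_one`, `tensorPt`, `IsSL3Invariant` (`BI17FundamentalInvariantTensors`,
`QuantumFunctionals…`); `exists_dual_homogeneousSubmodule_eq_sum`, `finite_homogeneousSubmodule`,
`isSemisimpleRepresentation_comp_iff` (`MultiplicityObstructionsProofs`);
`isSemisimpleRepresentation_of_forall_exists_eval` (`GLPolynomialRepSemisimpleProofs`).
-/

noncomputable section

open MvPolynomial
open scoped BigOperators Matrix

namespace Literature.Computability.AlgebraicComplexity

/-! ### The substitution `F ↦ F ∘ (A ⊗ B ⊗ C)` on `R[⊗³]` -/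

section Subst

variable {ι : Type*} [Fintype ι] [DecidableEq ι] {R : Type*} [CommRing R]

/-- **The substitution action on `R[⊗³R^ι] = MvPolynomial (ι × ι × ι) R`**: `tensorCoordSubst A B C`
replaces the coordinate `X_p`, `p = (a,b,c)`, by the linear form `∑_{q=(a',b',c')} A_{a a'} B_{b b'}
C_{c c'} X_q` — the `p`-th coordinate of `(A ⊗ B ⊗ C)·w` (`actTensor A B C w`) as a function of `w`.
Thus `tensorCoordSubst A B C F = F ∘ (A ⊗ B ⊗ C)` (`aeval_tensorPt_tensorCoordSubst`); the invariant ring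
`O(⊗³ℂ^m)^{SL_m^3}` of BI 2017 §5 is its fixed ring under `SL³`. Plumbing definition over any
commutative ring `R` (so that it can be base-changed to generic matrices). [folklore] -/
def tensorCoordSubst (A B C : Matrix ι ι R) :
    MvPolynomial (ι × ι × ι) R →ₐ[R] MvPolynomial (ι × ι × ι) R :=
  aeval fun p : ι × ι × ι =>
    ∑ q : ι × ι × ι, (A p.1 q.1 * B p.2.1 q.2.1 * C p.2.2 q.2.2) • (X q : MvPolynomial (ι × ι × ι) R)

omit [DecidableEq ι] in
/-- `tensorCoordSubst` on a coordinate function. [cite: BurgisserIkenmeyer2017, §5 (the action of GL_m^3 on O(⊗³ℂ^m), TeX L1945–1981)] -/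
@[simp]
theorem tensorCoordSubst_X (A B C : Matrix ι ι R) (p : ι × ι × ι) :
    tensorCoordSubst A B C (X p) =
      ∑ q : ι × ι × ι, (A p.1 q.1 * B p.2.1 q.2.1 * C p.2.2 q.2.2) • (X q : MvPolynomial (ι × ι × ι) R) := by
  rw [tensorCoordSubst, aeval_X]

omit [DecidableEq ι] in
/-- **Evaluation**: `(tensorCoordSubst A B C F)(w) = F((A ⊗ B ⊗ C)·w)`. [cite: BurgisserIkenmeyer2017, §5 (the action of GL_m^3 on O(⊗³ℂ^m), TeX L1945–1981)] -/
theorem aeval_tensorPt_tensorCoordSubst (A B C : Matrix ι ι R) (w : ι → ι → ι → R)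
    (F : MvPolynomial (ι × ι × ι) R) :
    aeval (tensorPt w) (tensorCoordSubst A B C F) = aeval (tensorPt (actTensor A B C w)) F := by
  have h : (aeval (tensorPt w)).comp (tensorCoordSubst A B C) =
      aeval (tensorPt (actTensor A B C w)) := by
    refine MvPolynomial.algHom_ext fun p => ?_
    rw [AlgHom.comp_apply, tensorCoordSubst_X, map_sum, aeval_X]
    simp only [map_smul, aeval_X, smul_eq_mul, tensorPt, actTensor_apply, Fintype.sum_prod_type]
  exact AlgHom.congr_fun h F

omit [Fintype ι] [DecidableEq ι] [CommRing R] in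
/-- Every point of `ι × ι × ι → R` is `tensorPt` of a (curried) tensor. [cite: BurgisserIkenmeyer2017, §5 (the action of GL_m^3 on O(⊗³ℂ^m), TeX L1945–1981)] -/
theorem tensorPt_surjective : Function.Surjective (tensorPt : (ι → ι → ι → R) → ι × ι × ι → R) :=
  fun x => ⟨fun a b c => x (a, b, c), funext fun p => by simp only [tensorPt]⟩

omit [DecidableEq ι] in
/-- `tensorCoordSubst` preserves homogeneity (it substitutes linear forms). [cite: BurgisserIkenmeyer2017, §5 (the action of GL_m^3 on O(⊗³ℂ^m), TeX L1945–1981)] -/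
theorem isHomogeneous_tensorCoordSubst {d : ℕ} (A B C : Matrix ι ι R) {F : MvPolynomial (ι × ι × ι) R}
    (hF : F.IsHomogeneous d) : (tensorCoordSubst A B C F).IsHomogeneous d := by
  have hg : ∀ p : ι × ι × ι, (∑ q : ι × ι × ι, (A p.1 q.1 * B p.2.1 q.2.1 * C p.2.2 q.2.2) •
      (X q : MvPolynomial (ι × ι × ι) R)).IsHomogeneous 1 := fun p => by
    refine IsHomogeneous.sum _ _ 1 fun q _ => ?_
    rw [smul_eq_C_mul]
    exact (isHomogeneous_X R q).C_mul _
  have h := hF.aeval _ hg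
  rw [one_mul] at h
  exact h

omit [DecidableEq ι] in
/-- **Base change**: `tensorCoordSubst` commutes with `MvPolynomial.map` along a ring homomorphism
(applied to the matrices entrywise). Used with the evaluation `R[X_{ij}] → R` of generic matrices.
[cite: BurgisserIkenmeyer2017, §5 (the action of GL_m^3 on O(⊗³ℂ^m), TeX L1945–1981)] -/
theorem map_tensorCoordSubst {S : Type*} [CommRing S] (f : R →+* S) (A B C : Matrix ι ι R)
    (F : MvPolynomial (ι × ι × ι) R) :
    map f (tensorCoordSubst A B C F) = tensorCoordSubst (A.map f) (B.map f) (C.map f) (map f F) := by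
  have hg : (fun p : ι × ι × ι => map f (∑ q : ι × ι × ι,
      (A p.1 q.1 * B p.2.1 q.2.1 * C p.2.2 q.2.2) • (X q : MvPolynomial (ι × ι × ι) R))) =
      fun p : ι × ι × ι => ∑ q : ι × ι × ι, (A.map f p.1 q.1 * B.map f p.2.1 q.2.1 * C.map f p.2.2 q.2.2) •
        (X q : MvPolynomial (ι × ι × ι) S) := by
    funext p
    rw [map_sum]
    refine Finset.sum_congr rfl fun q _ => ?_
    rw [smul_eq_C_mul, smul_eq_C_mul, map_mul, map_C, map_X]
    simp only [Matrix.map_apply, map_mul]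
  change map f (bind₁ _ F) = bind₁ _ (map f F)
  rw [map_bind₁, hg]

variable [IsDomain R] [Infinite R]

omit [Fintype ι] [DecidableEq ι] in
/-- Two polynomials on `⊗³` agreeing at every tensor are equal (`R` an infinite domain). [cite: BurgisserIkenmeyer2017, §5 (the action of GL_m^3 on O(⊗³ℂ^m), TeX L1945–1981)] -/
theorem eq_of_forall_aeval_tensorPt_eq {F G : MvPolynomial (ι × ι × ι) R}
    (h : ∀ w : ι → ι → ι → R, aeval (tensorPt w) F = aeval (tensorPt w) G) : F = G := by
  refine MvPolynomial.funext fun x => ?_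
  obtain ⟨w, rfl⟩ := tensorPt_surjective (R := R) x
  exact h w

/-- The identity substitution is the identity. [cite: BurgisserIkenmeyer2017, §5 (the action of GL_m^3 on O(⊗³ℂ^m), TeX L1945–1981)] -/
theorem tensorCoordSubst_one :
    tensorCoordSubst (1 : Matrix ι ι R) 1 1 = AlgHom.id R (MvPolynomial (ι × ι × ι) R) := by
  refine AlgHom.ext fun F => eq_of_forall_aeval_tensorPt_eq (R := R) fun w => ?_
  rw [aeval_tensorPt_tensorCoordSubst, actTensor_one, AlgHom.id_apply]

omit [DecidableEq ι] in
/-- **Anti-multiplicativity**: `F ∘ (AA' ⊗ BB' ⊗ CC') = (F ∘ (A ⊗ B ⊗ C)) ∘ (A' ⊗ B' ⊗ C')`, i.e.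
`tensorCoordSubst (AA') (BB') (CC') = tensorCoordSubst A' B' C' ∘ tensorCoordSubst A B C`. [cite: BurgisserIkenmeyer2017, §5 (the action of GL_m^3 on O(⊗³ℂ^m), TeX L1945–1981)] -/
theorem tensorCoordSubst_mul (A B C A' B' C' : Matrix ι ι R) :
    tensorCoordSubst (A * A') (B * B') (C * C') =
      (tensorCoordSubst A' B' C').comp (tensorCoordSubst A B C) := by
  refine AlgHom.ext fun F => eq_of_forall_aeval_tensorPt_eq (R := R) fun w => ?_
  rw [aeval_tensorPt_tensorCoordSubst, AlgHom.comp_apply, aeval_tensorPt_tensorCoordSubst,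
    aeval_tensorPt_tensorCoordSubst, actTensor_actTensor]

end Subst

/-! ### BI's pointwise `SL³`-invariance is invariance under the substitutions -/

section Invariance

variable {ι : Type*} [Fintype ι] [DecidableEq ι]

/-- **`IsSL3Invariant F` iff `F` is fixed by every substitution `F ↦ F ∘ (g₁ ⊗ g₂ ⊗ g₃)`, `gᵢ ∈ SL`**
(BI 2017 §5, the invariant ring `O(⊗³ℂ^m)^{SL_m^3}`, TeX L1981; over `ℂ` a polynomial is its
function). [cite: BurgisserIkenmeyer2017, §5 (the invariant ring, before Def. 5.2)] -/
theorem isSL3Invariant_iff_forall_tensorCoordSubst_eq (F : MvPolynomial (ι × ι × ι) ℂ) :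
    IsSL3Invariant F ↔ ∀ g₁ g₂ g₃ : Matrix.SpecialLinearGroup ι ℂ,
      tensorCoordSubst (g₁ : Matrix ι ι ℂ) (g₂ : Matrix ι ι ℂ) (g₃ : Matrix ι ι ℂ) F = F := by
  constructor
  · intro h g₁ g₂ g₃
    exact eq_of_forall_aeval_tensorPt_eq (R := ℂ) fun w => by
      rw [aeval_tensorPt_tensorCoordSubst, h g₁ g₂ g₃ w]
  · intro h g₁ g₂ g₃ w
    rw [← aeval_tensorPt_tensorCoordSubst, h g₁ g₂ g₃]

end Invariance

/-! ### The representation of `GL³` on `k[⊗³]` and its degree pieces -/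

section Rep

variable (ι : Type*) [Fintype ι] [DecidableEq ι] (k : Type*) [Field k] [Infinite k]

/-- **The representation of `GL ι k × GL ι k × GL ι k` on the coordinate ring `k[⊗³k^ι]`**:
`(g₁,g₂,g₃) ↦ (F ↦ F ∘ (g₁ᵀ ⊗ g₂ᵀ ⊗ g₃ᵀ))`. (The transpose twist makes this a left action with matrix
coefficients polynomial in the `gᵢ` — the same device as the inverse-transpose twist of `coordRep` in
`isSemisimpleRepresentation_coordRep`; its `SL³`-fixed vectors are BI's invariants,
`isSL3Invariant_iff_forall_tensorCoordRep_sl_eq`.) Plumbing definition. [folklore] -/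
def tensorCoordRep : Representation k (GL ι k × GL ι k × GL ι k) (MvPolynomial (ι × ι × ι) k) where
  toFun g := (tensorCoordSubst ((g.1 : Matrix ι ι k)ᵀ) ((g.2.1 : Matrix ι ι k)ᵀ)
    ((g.2.2 : Matrix ι ι k)ᵀ)).toLinearMap
  map_one' := by
    simp only [Prod.fst_one, Prod.snd_one, Units.val_one, Matrix.transpose_one, tensorCoordSubst_one]
    rfl
  map_mul' g h := by
    simp only [Prod.fst_mul, Prod.snd_mul, Units.val_mul, Matrix.transpose_mul, tensorCoordSubst_mul]
    rfl

variable {ι k}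

/-- Unfolding `tensorCoordRep`. [cite: BurgisserIkenmeyer2017, §5 (the action of GL_m^3 on O(⊗³ℂ^m), TeX L1945–1981)] -/
theorem tensorCoordRep_apply (g : GL ι k × GL ι k × GL ι k) (F : MvPolynomial (ι × ι × ι) k) :
    tensorCoordRep ι k g F = tensorCoordSubst ((g.1 : Matrix ι ι k)ᵀ) ((g.2.1 : Matrix ι ι k)ᵀ)
      ((g.2.2 : Matrix ι ι k)ᵀ) F := rfl

/-- The `SL³`-fixed vectors of `tensorCoordRep` are exactly BI's `SL³`-invariants (`SL` is closed under
transpose). [cite: BurgisserIkenmeyer2017, §5 (the invariant ring, before Def. 5.2)] -/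
theorem isSL3Invariant_iff_forall_tensorCoordRep_sl_eq (F : MvPolynomial (ι × ι × ι) ℂ) :
    IsSL3Invariant F ↔ ∀ g₁ g₂ g₃ : Matrix.SpecialLinearGroup ι ℂ,
      tensorCoordRep ι ℂ (Matrix.SpecialLinearGroup.toGL g₁, Matrix.SpecialLinearGroup.toGL g₂,
        Matrix.SpecialLinearGroup.toGL g₃) F = F := by
  rw [isSL3Invariant_iff_forall_tensorCoordSubst_eq]
  constructor
  · intro h g₁ g₂ g₃
    rw [tensorCoordRep_apply]
    simp only [Matrix.SpecialLinearGroup.coe_GL_coe_matrix]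
    exact h g₁.transpose g₂.transpose g₃.transpose
  · intro h g₁ g₂ g₃
    have h' := h g₁.transpose g₂.transpose g₃.transpose
    rw [tensorCoordRep_apply] at h'
    simp only [Matrix.SpecialLinearGroup.coe_GL_coe_matrix, Matrix.SpecialLinearGroup.coe_transpose,
      Matrix.transpose_transpose] at h'
    exact h'

variable (ι k)

/-- The degree-`d` piece `k[⊗³]_d` is a subrepresentation (substituting linear forms preserves the
degree). Plumbing definition. [folklore] -/
def tensorCoordRepDeg (d : ℕ) : Subrepresentation (tensorCoordRep ι k) where
  toSubmodule := homogeneousSubmodule (ι × ι × ι) k d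
  apply_mem_toSubmodule g _ hF := by
    rw [mem_homogeneousSubmodule, tensorCoordRep_apply]
    exact isHomogeneous_tensorCoordSubst _ _ _ ((mem_homogeneousSubmodule d _).mp hF)

variable {ι k}

/-- The underlying submodule of the degree piece. [cite: BurgisserIkenmeyer2017, §5 (the action of GL_m^3 on O(⊗³ℂ^m), TeX L1945–1981)] -/
@[simp]
theorem tensorCoordRepDeg_toSubmodule (d : ℕ) :
    (tensorCoordRepDeg ι k d).toSubmodule = homogeneousSubmodule (ι × ι × ι) k d := rfl

end Rep

/-! ### Each slot action on a degree piece is a polynomial representation, hence semisimple -/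

section Slots

variable {ι : Type*} [Fintype ι] [DecidableEq ι] {k : Type*} [Field k] [Infinite k]

omit [Infinite k] in
/-- **Generic substitution in slot 1 specialises**: the coefficients of `F ∘ (gᵀ ⊗ 1 ⊗ 1)` are the
values at `g` of the coefficients of `F ∘ (Xᵀ ⊗ 1 ⊗ 1)` computed over `k[X_{ij}]` with the generic
matrix `X = Matrix.mvPolynomialX`. [cite: BlaeserIkenmeyer2025, Example 11.2 (matrix coefficients of coordinate-ring actions are polynomial)] -/
theorem map_eval_tensorCoordSubst_generic₁ (A : Matrix ι ι k) (F : MvPolynomial (ι × ι × ι) k) :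
    map (eval fun ij : ι × ι => A ij.1 ij.2)
        (tensorCoordSubst ((Matrix.mvPolynomialX ι ι k)ᵀ) 1 1 (map C F)) =
      tensorCoordSubst Aᵀ 1 1 F := by
  rw [map_tensorCoordSubst, Matrix.map_one _ (map_zero _) (map_one _), map_map, Matrix.transpose_map]
  have hX : (Matrix.mvPolynomialX ι ι k).map (eval fun ij : ι × ι => A ij.1 ij.2) = A := by
    have h := Matrix.mvPolynomialX_mapMatrix_eval A
    rwa [RingHom.mapMatrix_apply] at h
  rw [hX]
  congr 1
  have hid : (eval fun ij : ι × ι => A ij.1 ij.2).comp (C : k →+* MvPolynomial (ι × ι) k) =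
      RingHom.id k := RingHom.ext fun c => eval_C _
  rw [hid, map_id]

omit [Infinite k] in
/-- Slot 2 version of `map_eval_tensorCoordSubst_generic₁`. [cite: BlaeserIkenmeyer2025, Example 11.2 (matrix coefficients of coordinate-ring actions are polynomial)] -/
theorem map_eval_tensorCoordSubst_generic₂ (B : Matrix ι ι k) (F : MvPolynomial (ι × ι × ι) k) :
    map (eval fun ij : ι × ι => B ij.1 ij.2)
        (tensorCoordSubst 1 ((Matrix.mvPolynomialX ι ι k)ᵀ) 1 (map C F)) =
      tensorCoordSubst 1 Bᵀ 1 F := by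
  rw [map_tensorCoordSubst, Matrix.map_one _ (map_zero _) (map_one _), map_map, Matrix.transpose_map]
  have hX : (Matrix.mvPolynomialX ι ι k).map (eval fun ij : ι × ι => B ij.1 ij.2) = B := by
    have h := Matrix.mvPolynomialX_mapMatrix_eval B
    rwa [RingHom.mapMatrix_apply] at h
  rw [hX]
  congr 1
  have hid : (eval fun ij : ι × ι => B ij.1 ij.2).comp (C : k →+* MvPolynomial (ι × ι) k) =
      RingHom.id k := RingHom.ext fun c => eval_C _
  rw [hid, map_id]

omit [Infinite k] in
/-- Slot 3 version of `map_eval_tensorCoordSubst_generic₁`. [cite: BlaeserIkenmeyer2025, Example 11.2 (matrix coefficients of coordinate-ring actions are polynomial)] -/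
theorem map_eval_tensorCoordSubst_generic₃ (C' : Matrix ι ι k) (F : MvPolynomial (ι × ι × ι) k) :
    map (eval fun ij : ι × ι => C' ij.1 ij.2)
        (tensorCoordSubst 1 1 ((Matrix.mvPolynomialX ι ι k)ᵀ) (map C F)) =
      tensorCoordSubst 1 1 C'ᵀ F := by
  rw [map_tensorCoordSubst, Matrix.map_one _ (map_zero _) (map_one _), map_map, Matrix.transpose_map]
  have hX : (Matrix.mvPolynomialX ι ι k).map (eval fun ij : ι × ι => C' ij.1 ij.2) = C' := by
    have h := Matrix.mvPolynomialX_mapMatrix_eval C'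
    rwa [RingHom.mapMatrix_apply] at h
  rw [hX]
  congr 1
  have hid : (eval fun ij : ι × ι => C' ij.1 ij.2).comp (C : k →+* MvPolynomial (ι × ι) k) =
      RingHom.id k := RingHom.ext fun c => eval_C _
  rw [hid, map_id]

/-- **The slot-1 action on `k[⊗³]_d` is a polynomial representation**: every matrix coefficient
`g ↦ φ((g,1,1)·v)` is the evaluation at `g` of a polynomial in the entries of `g`. [cite: BlaeserIkenmeyer2025, Example 11.2 (matrix coefficients of coordinate-ring actions are polynomial)] -/
theorem exists_eval_tensorCoordRepDeg_slot₁ (d : ℕ) (v : (tensorCoordRepDeg ι k d).toSubmodule)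
    (φ : Module.Dual k (tensorCoordRepDeg ι k d).toSubmodule) :
    ∃ P : MvPolynomial (ι × ι) k, ∀ g : GL ι k,
      φ (((tensorCoordRepDeg ι k d).toRepresentation.comp
          (MonoidHom.inl (GL ι k) (GL ι k × GL ι k))) g v) =
        eval (fun ij : ι × ι => (g : Matrix ι ι k) ij.1 ij.2) P := by
  classical
  obtain ⟨D, c, hφ⟩ := exists_dual_homogeneousSubmodule_eq_sum d φ
  have hφ' : ∀ x : (tensorCoordRepDeg ι k d).toSubmodule,
      φ x = ∑ e ∈ D, coeff e (x : MvPolynomial (ι × ι × ι) k) * c e := hφ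
  refine ⟨∑ e ∈ D, coeff e (tensorCoordSubst ((Matrix.mvPolynomialX ι ι k)ᵀ) 1 1
    (map C (v : MvPolynomial (ι × ι × ι) k))) * C (c e), fun g => ?_⟩
  rw [hφ', map_sum]
  refine Finset.sum_congr rfl fun e _ => ?_
  rw [map_mul, eval_C, ← coeff_map, map_eval_tensorCoordSubst_generic₁]
  simp only [MonoidHom.coe_comp, Function.comp_apply, MonoidHom.inl_apply,
    Subrepresentation.toRepresentation, MonoidHom.coe_mk, OneHom.coe_mk, LinearMap.coe_restrict_apply,
    tensorCoordRep_apply, Prod.fst_one, Prod.snd_one, Units.val_one, Matrix.transpose_one]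

/-- Slot 2 version of `exists_eval_tensorCoordRepDeg_slot₁`. [cite: BlaeserIkenmeyer2025, Example 11.2 (matrix coefficients of coordinate-ring actions are polynomial)] -/
theorem exists_eval_tensorCoordRepDeg_slot₂ (d : ℕ) (v : (tensorCoordRepDeg ι k d).toSubmodule)
    (φ : Module.Dual k (tensorCoordRepDeg ι k d).toSubmodule) :
    ∃ P : MvPolynomial (ι × ι) k, ∀ g : GL ι k,
      φ (((tensorCoordRepDeg ι k d).toRepresentation.comp
          ((MonoidHom.inr (GL ι k) (GL ι k × GL ι k)).comp (MonoidHom.inl (GL ι k) (GL ι k)))) g v) =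
        eval (fun ij : ι × ι => (g : Matrix ι ι k) ij.1 ij.2) P := by
  classical
  obtain ⟨D, c, hφ⟩ := exists_dual_homogeneousSubmodule_eq_sum d φ
  have hφ' : ∀ x : (tensorCoordRepDeg ι k d).toSubmodule,
      φ x = ∑ e ∈ D, coeff e (x : MvPolynomial (ι × ι × ι) k) * c e := hφ
  refine ⟨∑ e ∈ D, coeff e (tensorCoordSubst 1 ((Matrix.mvPolynomialX ι ι k)ᵀ) 1
    (map C (v : MvPolynomial (ι × ι × ι) k))) * C (c e), fun g => ?_⟩
  rw [hφ', map_sum]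
  refine Finset.sum_congr rfl fun e _ => ?_
  rw [map_mul, eval_C, ← coeff_map, map_eval_tensorCoordSubst_generic₂]
  simp only [MonoidHom.coe_comp, Function.comp_apply, MonoidHom.inl_apply, MonoidHom.inr_apply,
    Subrepresentation.toRepresentation, MonoidHom.coe_mk, OneHom.coe_mk, LinearMap.coe_restrict_apply,
    tensorCoordRep_apply, Units.val_one, Matrix.transpose_one]

/-- Slot 3 version of `exists_eval_tensorCoordRepDeg_slot₁`. [cite: BlaeserIkenmeyer2025, Example 11.2 (matrix coefficients of coordinate-ring actions are polynomial)] -/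
theorem exists_eval_tensorCoordRepDeg_slot₃ (d : ℕ) (v : (tensorCoordRepDeg ι k d).toSubmodule)
    (φ : Module.Dual k (tensorCoordRepDeg ι k d).toSubmodule) :
    ∃ P : MvPolynomial (ι × ι) k, ∀ g : GL ι k,
      φ (((tensorCoordRepDeg ι k d).toRepresentation.comp
          ((MonoidHom.inr (GL ι k) (GL ι k × GL ι k)).comp (MonoidHom.inr (GL ι k) (GL ι k)))) g v) =
        eval (fun ij : ι × ι => (g : Matrix ι ι k) ij.1 ij.2) P := by
  classical
  obtain ⟨D, c, hφ⟩ := exists_dual_homogeneousSubmodule_eq_sum d φ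
  have hφ' : ∀ x : (tensorCoordRepDeg ι k d).toSubmodule,
      φ x = ∑ e ∈ D, coeff e (x : MvPolynomial (ι × ι × ι) k) * c e := hφ
  refine ⟨∑ e ∈ D, coeff e (tensorCoordSubst 1 1 ((Matrix.mvPolynomialX ι ι k)ᵀ)
    (map C (v : MvPolynomial (ι × ι × ι) k))) * C (c e), fun g => ?_⟩
  rw [hφ', map_sum]
  refine Finset.sum_congr rfl fun e _ => ?_
  rw [map_mul, eval_C, ← coeff_map, map_eval_tensorCoordSubst_generic₃]
  simp only [MonoidHom.coe_comp, Function.comp_apply, MonoidHom.inr_apply,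
    Subrepresentation.toRepresentation, MonoidHom.coe_mk, OneHom.coe_mk, LinearMap.coe_restrict_apply,
    tensorCoordRep_apply, Units.val_one, Matrix.transpose_one]

variable [CharZero k]

/-- **The slot-1 action of `GL ι k` on `k[⊗³]_d` is completely reducible** (a polynomial
representation of `GL_N` over a field of characteristic zero: Bläser–Ikenmeyer Thm. 10.9, here via
the tree's `isSemisimpleRepresentation_of_forall_exists_eval`).
[cite: BlaeserIkenmeyer2025, Thm. 10.9 with Example 11.2] -/
theorem isSemisimpleRepresentation_tensorCoordRepDeg_slot₁ (d : ℕ) :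
    Representation.IsSemisimpleRepresentation (k := k) (G := GL ι k)
      ((tensorCoordRepDeg ι k d).toRepresentation.comp
        (MonoidHom.inl (GL ι k) (GL ι k × GL ι k))) := by
  haveI : Module.Finite k (tensorCoordRepDeg ι k d).toSubmodule := finite_homogeneousSubmodule _ _ _
  exact Literature.NumberTheory.DiophantineGeometry.isSemisimpleRepresentation_of_forall_exists_eval
    (exists_eval_tensorCoordRepDeg_slot₁ d)

/-- **The slot-2 action of `GL ι k` on `k[⊗³]_d` is completely reducible.**
[cite: BlaeserIkenmeyer2025, Thm. 10.9 with Example 11.2] -/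
theorem isSemisimpleRepresentation_tensorCoordRepDeg_slot₂ (d : ℕ) :
    Representation.IsSemisimpleRepresentation (k := k) (G := GL ι k)
      ((tensorCoordRepDeg ι k d).toRepresentation.comp
        ((MonoidHom.inr (GL ι k) (GL ι k × GL ι k)).comp
          (MonoidHom.inl (GL ι k) (GL ι k)))) := by
  haveI : Module.Finite k (tensorCoordRepDeg ι k d).toSubmodule := finite_homogeneousSubmodule _ _ _
  exact Literature.NumberTheory.DiophantineGeometry.isSemisimpleRepresentation_of_forall_exists_eval
    (exists_eval_tensorCoordRepDeg_slot₂ d)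

/-- **The slot-3 action of `GL ι k` on `k[⊗³]_d` is completely reducible.**
[cite: BlaeserIkenmeyer2025, Thm. 10.9 with Example 11.2] -/
theorem isSemisimpleRepresentation_tensorCoordRepDeg_slot₃ (d : ℕ) :
    Representation.IsSemisimpleRepresentation (k := k) (G := GL ι k)
      ((tensorCoordRepDeg ι k d).toRepresentation.comp
        ((MonoidHom.inr (GL ι k) (GL ι k × GL ι k)).comp
          (MonoidHom.inr (GL ι k) (GL ι k)))) := by
  haveI : Module.Finite k (tensorCoordRepDeg ι k d).toSubmodule := finite_homogeneousSubmodule _ _ _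
  exact Literature.NumberTheory.DiophantineGeometry.isSemisimpleRepresentation_of_forall_exists_eval
    (exists_eval_tensorCoordRepDeg_slot₃ d)

end Slots

/-! ### The slot actions of `SL` on a degree piece are completely reducible (`GL = ℂ^× · SL`) -/

section SLSlots

variable {ι : Type*} [Fintype ι] [DecidableEq ι]

/-- Scalars in a slot act on the degree-`d` piece by scalars: `F ∘ (s·1 ⊗ 1 ⊗ 1) = s^d F` for `F`
homogeneous of degree `d` (likewise in the other slots). [cite: BurgisserIkenmeyer2017, Lemma 5.1 (1) (proof: gᵢ = tᵢ sᵢ, sᵢ ∈ SL_m)] -/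
theorem tensorCoordSubst_smul_one_of_isHomogeneous {d : ℕ} (s : ℂ) {F : MvPolynomial (ι × ι × ι) ℂ}
    (hF : F.IsHomogeneous d) :
    tensorCoordSubst (s • (1 : Matrix ι ι ℂ)) 1 1 F = s ^ d • F ∧
      tensorCoordSubst 1 (s • (1 : Matrix ι ι ℂ)) 1 F = s ^ d • F ∧
      tensorCoordSubst 1 1 (s • (1 : Matrix ι ι ℂ)) F = s ^ d • F := by
  have key : ∀ w : ι → ι → ι → ℂ, aeval (tensorPt (s • w)) F = aeval (tensorPt w) (s ^ d • F) := by
    intro w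
    rw [map_smul, show tensorPt (s • w) = s • tensorPt w from rfl, smul_eq_mul]
    simp only [MvPolynomial.aeval_eq_eval]
    exact hF.eval_smul_eq s (tensorPt w)
  refine ⟨?_, ?_, ?_⟩ <;> refine eq_of_forall_aeval_tensorPt_eq (R := ℂ) fun w => ?_ <;>
    rw [aeval_tensorPt_tensorCoordSubst]
  · rw [actTensor_smul_fst, actTensor_one, key]
  · rw [actTensor_smul_snd, actTensor_one, key]
  · rw [actTensor_smul_thd, actTensor_one, key]

/-- `GL_ι(ℂ) = ℂ^× · SL_ι(ℂ)`: every `g` is `(s·1)·h` with `h ∈ SL` (`s^{|ι|} = det g`). [cite: BurgisserIkenmeyer2017, Lemma 5.1 (1) (proof: gᵢ = tᵢ sᵢ, sᵢ ∈ SL_m)] -/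
theorem exists_eq_smul_one_mul_sl [Nonempty ι] (g : GL ι ℂ) :
    ∃ (s : ℂ) (h : Matrix.SpecialLinearGroup ι ℂ), s ≠ 0 ∧
      (g : Matrix ι ι ℂ) = (s • (1 : Matrix ι ι ℂ)) * (h : Matrix ι ι ℂ) := by
  have hm : 0 < Fintype.card ι := Fintype.card_pos
  obtain ⟨s, hs⟩ := IsAlgClosed.exists_pow_nat_eq (Matrix.det (g : Matrix ι ι ℂ)) hm
  have hs0 : s ≠ 0 := by
    rintro rfl
    rw [zero_pow hm.ne'] at hs
    exact Matrix.GeneralLinearGroup.det_ne_zero g hs.symm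
  refine ⟨s, ⟨s⁻¹ • (g : Matrix ι ι ℂ), ?_⟩, hs0, ?_⟩
  · rw [Matrix.det_smul, ← hs, inv_pow, inv_mul_cancel₀ (pow_ne_zero _ hs0)]
  · change (g : Matrix ι ι ℂ) = (s • (1 : Matrix ι ι ℂ)) * (s⁻¹ • (g : Matrix ι ι ℂ))
    rw [smul_mul_assoc, one_mul, smul_smul, mul_inv_cancel₀ hs0, one_smul]

/-- On the degree-`d` piece, a slot-`i` element `g = (s·1)h`, `h ∈ SL`, acts as `s^d` times the action
of `h`: the three slots at once, for the representation `tensorCoordRep`. [cite: BurgisserIkenmeyer2017, Lemma 5.1 (1) (proof: gᵢ = tᵢ sᵢ, sᵢ ∈ SL_m)] -/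
theorem tensorCoordRepDeg_slot_smul_one_mul {d : ℕ} {s : ℂ} (h : Matrix ι ι ℂ) (g : GL ι ℂ)
    (hg : (g : Matrix ι ι ℂ) = (s • (1 : Matrix ι ι ℂ)) * h) (v : (tensorCoordRepDeg ι ℂ d).toSubmodule) :
    ((tensorCoordRep ι ℂ (g, 1) v : MvPolynomial (ι × ι × ι) ℂ) = s ^ d • tensorCoordSubst hᵀ 1 1 v) ∧
    ((tensorCoordRep ι ℂ (1, g, 1) v : MvPolynomial (ι × ι × ι) ℂ) = s ^ d • tensorCoordSubst 1 hᵀ 1 v) ∧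
    ((tensorCoordRep ι ℂ (1, 1, g) v : MvPolynomial (ι × ι × ι) ℂ) = s ^ d • tensorCoordSubst 1 1 hᵀ v) := by
  have hv : (v : MvPolynomial (ι × ι × ι) ℂ).IsHomogeneous d := (mem_homogeneousSubmodule d _).mp v.2
  have hgT : (g : Matrix ι ι ℂ)ᵀ = hᵀ * (s • (1 : Matrix ι ι ℂ)) := by
    rw [hg, Matrix.transpose_mul, Matrix.transpose_smul, Matrix.transpose_one]
  have hF := isHomogeneous_tensorCoordSubst hᵀ 1 1 hv
  have hF₂ := isHomogeneous_tensorCoordSubst 1 hᵀ 1 hv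
  have hF₃ := isHomogeneous_tensorCoordSubst 1 1 hᵀ hv
  have e1 : tensorCoordSubst (hᵀ * (s • (1 : Matrix ι ι ℂ))) 1 1 =
      (tensorCoordSubst (s • (1 : Matrix ι ι ℂ)) 1 1).comp (tensorCoordSubst hᵀ 1 1) := by
    have := tensorCoordSubst_mul hᵀ 1 1 (s • (1 : Matrix ι ι ℂ)) 1 1
    rwa [mul_one] at this
  have e2 : tensorCoordSubst 1 (hᵀ * (s • (1 : Matrix ι ι ℂ))) 1 =
      (tensorCoordSubst 1 (s • (1 : Matrix ι ι ℂ)) 1).comp (tensorCoordSubst 1 hᵀ 1) := by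
    have := tensorCoordSubst_mul 1 hᵀ 1 1 (s • (1 : Matrix ι ι ℂ)) 1
    rwa [mul_one] at this
  have e3 : tensorCoordSubst 1 1 (hᵀ * (s • (1 : Matrix ι ι ℂ))) =
      (tensorCoordSubst 1 1 (s • (1 : Matrix ι ι ℂ))).comp (tensorCoordSubst 1 1 hᵀ) := by
    have := tensorCoordSubst_mul 1 1 hᵀ 1 1 (s • (1 : Matrix ι ι ℂ))
    rwa [mul_one] at this
  refine ⟨?_, ?_, ?_⟩
  · rw [tensorCoordRep_apply]
    simp only [Prod.fst_one, Prod.snd_one, Units.val_one, Matrix.transpose_one]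
    rw [hgT, e1, AlgHom.comp_apply, (tensorCoordSubst_smul_one_of_isHomogeneous s hF).1]
  · rw [tensorCoordRep_apply]
    simp only [Units.val_one, Matrix.transpose_one]
    rw [hgT, e2, AlgHom.comp_apply, (tensorCoordSubst_smul_one_of_isHomogeneous s hF₂).2.1]
  · rw [tensorCoordRep_apply]
    simp only [Units.val_one, Matrix.transpose_one]
    rw [hgT, e3, AlgHom.comp_apply, (tensorCoordSubst_smul_one_of_isHomogeneous s hF₃).2.2]

/-- If a representation `ρ'` has the same stable subspaces as a semisimple representation `ρ` on the
same space (here: every `ρ`-translate is a scalar multiple of a `ρ'`-translate and conversely `ρ'`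
factors through `ρ`), then `ρ'` is semisimple. Abstract lattice transfer. [cite: BlaeserIkenmeyer2025, Thm. 10.9] -/
theorem isSemisimpleRepresentation_of_orderIso {k G H V : Type*} [Field k] [Monoid G] [Monoid H]
    [AddCommGroup V] [Module k V] {ρ : Representation k G V} {ρ' : Representation k H V}
    (e : Subrepresentation ρ' ≃o Subrepresentation ρ) (h : ρ.IsSemisimpleRepresentation) :
    ρ'.IsSemisimpleRepresentation :=
  e.complementedLattice_iff.mpr h

/-- **The slot-1 action of `SL ι ℂ` on `ℂ[⊗³]_d` is completely reducible**: its stable subspaces are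
the `GL`-stable ones (`GL = ℂ^× · SL`, scalars acting by `s^d`), and the `GL`-slot action is semisimple
(`isSemisimpleRepresentation_tensorCoordRepDeg_slot₁`). This is the linear reductivity of `SL_m` in
the first factor used for `O(⊗³ℂ^m)^{SL_m^3}` in BI 2017 §5.
[cite: BlaeserIkenmeyer2025, Thm. 10.9 with Example 11.2] -/
theorem isSemisimpleRepresentation_tensorCoordRepDeg_sl_slot₁ [Nonempty ι] (d : ℕ) :
    Representation.IsSemisimpleRepresentation (k := ℂ) (G := Matrix.SpecialLinearGroup ι ℂ)
      ((tensorCoordRepDeg ι ℂ d).toRepresentation.comp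
        ((MonoidHom.inl (GL ι ℂ) (GL ι ℂ × GL ι ℂ)).comp Matrix.SpecialLinearGroup.toGL)) := by
  refine isSemisimpleRepresentation_of_orderIso ?_ (isSemisimpleRepresentation_tensorCoordRepDeg_slot₁ d)
  exact
    { toFun := fun U => ⟨U.toSubmodule, fun g v hv => by
        obtain ⟨s, h, hs, hg⟩ := exists_eq_smul_one_mul_sl g
        have key : ((tensorCoordRepDeg ι ℂ d).toRepresentation.comp
            (MonoidHom.inl (GL ι ℂ) (GL ι ℂ × GL ι ℂ))) g v =
            s ^ d • ((tensorCoordRepDeg ι ℂ d).toRepresentation.comp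
              ((MonoidHom.inl (GL ι ℂ) (GL ι ℂ × GL ι ℂ)).comp Matrix.SpecialLinearGroup.toGL)) h v := by
          apply Subtype.ext
          have h1 := (tensorCoordRepDeg_slot_smul_one_mul (d := d) (h : Matrix ι ι ℂ) g hg v).1
          have h2 := (tensorCoordRepDeg_slot_smul_one_mul (d := d) (h : Matrix ι ι ℂ)
            (Matrix.SpecialLinearGroup.toGL h) (s := 1) (by
              rw [one_smul, one_mul, Matrix.SpecialLinearGroup.coe_GL_coe_matrix]) v).1
          rw [one_pow, one_smul] at h2
          simp only [MonoidHom.coe_comp, Function.comp_apply, MonoidHom.inl_apply,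
            Subrepresentation.toRepresentation, MonoidHom.coe_mk, OneHom.coe_mk,
            LinearMap.coe_restrict_apply, Submodule.coe_smul]
          rw [h1, h2]
        rw [key]
        exact U.toSubmodule.smul_mem _ (U.apply_mem_toSubmodule h hv)⟩
      invFun := fun U => ⟨U.toSubmodule, fun h v hv =>
        U.apply_mem_toSubmodule (Matrix.SpecialLinearGroup.toGL h) hv⟩
      left_inv := fun _ => rfl
      right_inv := fun _ => rfl
      map_rel_iff' := Iff.rfl }

/-- **The slot-2 action of `SL ι ℂ` on `ℂ[⊗³]_d` is completely reducible.**
[cite: BlaeserIkenmeyer2025, Thm. 10.9 with Example 11.2] -/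
theorem isSemisimpleRepresentation_tensorCoordRepDeg_sl_slot₂ [Nonempty ι] (d : ℕ) :
    Representation.IsSemisimpleRepresentation (k := ℂ) (G := Matrix.SpecialLinearGroup ι ℂ)
      ((tensorCoordRepDeg ι ℂ d).toRepresentation.comp
        (((MonoidHom.inr (GL ι ℂ) (GL ι ℂ × GL ι ℂ)).comp (MonoidHom.inl (GL ι ℂ) (GL ι ℂ))).comp
          Matrix.SpecialLinearGroup.toGL)) := by
  refine isSemisimpleRepresentation_of_orderIso ?_ (isSemisimpleRepresentation_tensorCoordRepDeg_slot₂ d)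
  exact
    { toFun := fun U => ⟨U.toSubmodule, fun g v hv => by
        obtain ⟨s, h, hs, hg⟩ := exists_eq_smul_one_mul_sl g
        have key : ((tensorCoordRepDeg ι ℂ d).toRepresentation.comp
            ((MonoidHom.inr (GL ι ℂ) (GL ι ℂ × GL ι ℂ)).comp (MonoidHom.inl (GL ι ℂ) (GL ι ℂ)))) g v =
            s ^ d • ((tensorCoordRepDeg ι ℂ d).toRepresentation.comp
              (((MonoidHom.inr (GL ι ℂ) (GL ι ℂ × GL ι ℂ)).comp (MonoidHom.inl (GL ι ℂ) (GL ι ℂ))).comp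
                Matrix.SpecialLinearGroup.toGL)) h v := by
          apply Subtype.ext
          have h1 := (tensorCoordRepDeg_slot_smul_one_mul (d := d) (h : Matrix ι ι ℂ) g hg v).2.1
          have h2 := (tensorCoordRepDeg_slot_smul_one_mul (d := d) (h : Matrix ι ι ℂ)
            (Matrix.SpecialLinearGroup.toGL h) (s := 1) (by
              rw [one_smul, one_mul, Matrix.SpecialLinearGroup.coe_GL_coe_matrix]) v).2.1
          rw [one_pow, one_smul] at h2
          simp only [MonoidHom.coe_comp, Function.comp_apply, MonoidHom.inl_apply, MonoidHom.inr_apply,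
            Subrepresentation.toRepresentation, MonoidHom.coe_mk, OneHom.coe_mk,
            LinearMap.coe_restrict_apply, Submodule.coe_smul]
          rw [h1, h2]
        rw [key]
        exact U.toSubmodule.smul_mem _ (U.apply_mem_toSubmodule h hv)⟩
      invFun := fun U => ⟨U.toSubmodule, fun h v hv =>
        U.apply_mem_toSubmodule (Matrix.SpecialLinearGroup.toGL h) hv⟩
      left_inv := fun _ => rfl
      right_inv := fun _ => rfl
      map_rel_iff' := Iff.rfl }

/-- **The slot-3 action of `SL ι ℂ` on `ℂ[⊗³]_d` is completely reducible.**
[cite: BlaeserIkenmeyer2025, Thm. 10.9 with Example 11.2] -/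
theorem isSemisimpleRepresentation_tensorCoordRepDeg_sl_slot₃ [Nonempty ι] (d : ℕ) :
    Representation.IsSemisimpleRepresentation (k := ℂ) (G := Matrix.SpecialLinearGroup ι ℂ)
      ((tensorCoordRepDeg ι ℂ d).toRepresentation.comp
        (((MonoidHom.inr (GL ι ℂ) (GL ι ℂ × GL ι ℂ)).comp (MonoidHom.inr (GL ι ℂ) (GL ι ℂ))).comp
          Matrix.SpecialLinearGroup.toGL)) := by
  refine isSemisimpleRepresentation_of_orderIso ?_ (isSemisimpleRepresentation_tensorCoordRepDeg_slot₃ d)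
  exact
    { toFun := fun U => ⟨U.toSubmodule, fun g v hv => by
        obtain ⟨s, h, hs, hg⟩ := exists_eq_smul_one_mul_sl g
        have key : ((tensorCoordRepDeg ι ℂ d).toRepresentation.comp
            ((MonoidHom.inr (GL ι ℂ) (GL ι ℂ × GL ι ℂ)).comp (MonoidHom.inr (GL ι ℂ) (GL ι ℂ)))) g v =
            s ^ d • ((tensorCoordRepDeg ι ℂ d).toRepresentation.comp
              (((MonoidHom.inr (GL ι ℂ) (GL ι ℂ × GL ι ℂ)).comp (MonoidHom.inr (GL ι ℂ) (GL ι ℂ))).comp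
                Matrix.SpecialLinearGroup.toGL)) h v := by
          apply Subtype.ext
          have h1 := (tensorCoordRepDeg_slot_smul_one_mul (d := d) (h : Matrix ι ι ℂ) g hg v).2.2
          have h2 := (tensorCoordRepDeg_slot_smul_one_mul (d := d) (h : Matrix ι ι ℂ)
            (Matrix.SpecialLinearGroup.toGL h) (s := 1) (by
              rw [one_smul, one_mul, Matrix.SpecialLinearGroup.coe_GL_coe_matrix]) v).2.2
          rw [one_pow, one_smul] at h2
          simp only [MonoidHom.coe_comp, Function.comp_apply, MonoidHom.inr_apply,
            Subrepresentation.toRepresentation, MonoidHom.coe_mk, OneHom.coe_mk,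
            LinearMap.coe_restrict_apply, Submodule.coe_smul]
          rw [h1, h2]
        rw [key]
        exact U.toSubmodule.smul_mem _ (U.apply_mem_toSubmodule h hv)⟩
      invFun := fun U => ⟨U.toSubmodule, fun h v hv =>
        U.apply_mem_toSubmodule (Matrix.SpecialLinearGroup.toGL h) hv⟩
      left_inv := fun _ => rfl
      right_inv := fun _ => rfl
      map_rel_iff' := Iff.rfl }

end SLSlots

end Literature.Computability.AlgebraicComplexity
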